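/-
Width seat `ym-line-cbag-p1-w3` (prover-ym-line-cbag-p1-w3-g8-0), following its lead onto LINE 5 `route-QuantumFields-HankelDensitySplitting`,
crux `HankelDensityFloor` (stmt-QuantumFields-26618), registered stub 1 `stub_hankelFixedDistanceLower` (the cross-plane fixed-distance local
law): the route-independent core — the second-order local free-gluon law for EVERY PAIR OF PLAQUETTES.
-/
import Summits.QuantumFields.YangMills.Theorems.DirichletWindowLocalGaussianitySecondOrder
import Literature.MathematicalPhysics.QuantumFieldTheory.LatticeGaugeStaticPotentialProofs
import Literature.MathematicalPhysics.QuantumFieldTheory.WilsonAxisSymmetry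
import Literature.Barriers.QuantumFields.AbelianDeconfinementD4Proofs
import Summits.QuantumFields.YangMills.Theorems.HankelDensitySplittingHankelDensityFloorNearUpper
import HarnessLib

/-!
# The second-order local free-gluon law for every plaquette pair (cross-plane fixed-distance Gaussianity)

Support file for crux `HankelDensityFloor` (stmt-QuantumFields-26618) of route `HankelDensitySplitting`, stub 1
`stub_hankelFixedDistanceLower` — the plane-generic twin of `SecondOrder.secondOrder_of_expMoment`
(`Theorems/DirichletWindowLocalGaussianitySecondOrder.lean`, the `(0,1) × (0,1)` in-line case):

* `CrossPlane.cov_scaled_eq` — the covariance of the scaled costs `β(N − P_p)`, `β(N − P_q)` in a state `μ` is `β² · plaquetteCorr ρ μ p q`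
  for ANY two plaquettes `p = (x;i,j)`, `q = (y;k,l)`;
* `CrossPlane.expMoment_allPlanes` — the chessboard exponential moment `∫ exp((β/2)(N − Re tr r(U_{(x;0,1)}))) dν ≤ C` over ALL limit states `ν`
  gives the same bound for every plaquette `(y;k,l)`, `k < l`, of every limit state (translates and axis permutations of limit states are limit
  states: `map_configShift_mem_infiniteVolumeLimitPoints`, `map_configPermZd_mem_infiniteVolumeLimitPoints`);
* `CrossPlane.secondOrder_pair_of_expMoment` — for a compact simple `G` (Borel σ-algebra `borel G`) and a faithful unitary `r`, GIVEN the
  free-energy asymptotics `f_r(β) + (3D_r/2) log β → K` and the exponential moments in all planes: there is `D ≥ 1` with, for every two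
  plaquettes `p, q` and `ε > 0`, eventually in `β` and uniformly over `μ ∈ infiniteVolumeLimitPoints r.ρ β`,
  `|β² · plaquetteCorr r.ρ μ p q − (D/2) · (curvatureTwoPoint p q)²| < ε`.
  Proof verbatim the in-line one (contradiction wrapper; tangent law `EquipartitionPinsProbe.stub_tangent` — whose clause (T0) is stated for
  arbitrary finite plaquette families — fed with `stub_equipartition`; rigidity `stub_rigidity` ⇒ `curvatureGaussianField 4 D`; truncation
  error `O(1/M)` from the exponential moments, `abs_cov_sub_truncated_le`; Gaussian side `GaussMoments.tendsto_truncated_cov p q`, Isserlis).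

References: S. Chatterjee, arXiv:1602.01222 §§11–14, arXiv:1803.01950 Problem 5.1; Fröhlich–Israel–Lieb–Simon 1978.  [folklore] bookkeeping;
RECORD-type material; the Yang–Mills mass gap is NOT proved here.
-/

set_option autoImplicit false

noncomputable section

open MeasureTheory Filter Topology
open Literature.MathematicalPhysics.QuantumFieldTheory Literature.MathematicalPhysics.QuantumLattice

namespace Summit.QuantumFields.YangMills.Theorems.HankelDensitySplitting

namespace CrossPlane

/-! ### Covariance of scaled plaquette costs = `β²` × plaquette correlation, any two plaquettes -/

section Lattice

variable {G : Type} [Group G] [MeasurableSpace G] {N : ℕ} (ρ : G →* Matrix (Fin N) (Fin N) ℂ)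

/-- For a probability measure `μ` on `LGConfig 4 G` and integrable plaquette observables: the covariance of the scaled costs
`β(N − P_{(x;i,j)})`, `β(N − P_{(y;k,l)})` is `β² · plaquetteCorr ρ μ x i j y k l`. [folklore] -/
theorem cov_scaled_eq (μ : Measure (LGConfig 4 G)) [IsProbabilityMeasure μ] (β : ℝ)
    (x : Literature.Probability.LatticeModels.Site 4) (i j : Fin 4) (y : Literature.Probability.LatticeModels.Site 4) (k l : Fin 4)
    (hx : Integrable (plaquetteObs ρ x i j) μ) (hy : Integrable (plaquetteObs ρ y k l) μ)
    (hxy : Integrable (fun U => plaquetteObs ρ x i j U * plaquetteObs ρ y k l U) μ) :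
    (∫ U, (β * ((N : ℝ) - plaquetteObs ρ x i j U)) * (β * ((N : ℝ) - plaquetteObs ρ y k l U)) ∂μ) -
      (∫ U, β * ((N : ℝ) - plaquetteObs ρ x i j U) ∂μ) * (∫ U, β * ((N : ℝ) - plaquetteObs ρ y k l U) ∂μ) =
      β ^ 2 * plaquetteCorr ρ μ x i j y k l := by
  have hprod : ∀ U, (β * ((N : ℝ) - plaquetteObs ρ x i j U)) * (β * ((N : ℝ) - plaquetteObs ρ y k l U)) =
      β ^ 2 * (N : ℝ) ^ 2 - β ^ 2 * N * plaquetteObs ρ y k l U - β ^ 2 * N * plaquetteObs ρ x i j U +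
        β ^ 2 * (plaquetteObs ρ x i j U * plaquetteObs ρ y k l U) := fun U => by ring
  have hlin : ∀ (f : LGConfig 4 G → ℝ), Integrable f μ →
      ∫ U, β * ((N : ℝ) - f U) ∂μ = β * N - β * ∫ U, f U ∂μ := by
    intro f hf
    rw [integral_const_mul, integral_sub (integrable_const _) hf, integral_const, probReal_univ, one_smul]
    ring
  simp_rw [hprod]
  have i1 : Integrable (fun U => β ^ 2 * (N : ℝ) ^ 2 - β ^ 2 * N * plaquetteObs ρ y k l U -
      β ^ 2 * N * plaquetteObs ρ x i j U) μ := ((integrable_const _).sub (hy.const_mul _)).sub (hx.const_mul _)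
  have i2 : Integrable (fun U => β ^ 2 * (plaquetteObs ρ x i j U * plaquetteObs ρ y k l U)) μ := hxy.const_mul _
  have i3 : Integrable (fun U => β ^ 2 * (N : ℝ) ^ 2 - β ^ 2 * N * plaquetteObs ρ y k l U) μ :=
    (integrable_const _).sub (hy.const_mul _)
  have i4 : Integrable (fun U => β ^ 2 * N * plaquetteObs ρ y k l U) μ := hy.const_mul _
  have i5 : Integrable (fun U => β ^ 2 * N * plaquetteObs ρ x i j U) μ := hx.const_mul _
  rw [integral_add i1 i2, integral_sub i3 i5, integral_sub (integrable_const _) i4, integral_const,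
    probReal_univ, one_smul, integral_const_mul, integral_const_mul, integral_const_mul, hlin _ hx, hlin _ hy]
  unfold plaquetteCorr
  ring

end Lattice

/-! ### Exponential moments in every plane from the `(0,1)` plane -/

section Symmetry

variable {N : ℕ} {G : Type} [Group G] [TopologicalSpace G] [IsTopologicalGroup G] [CompactSpace G]
  [MeasurableSpace G] [BorelSpace G]

/-- **Exponential moments of every plaquette cost of a limit state from the `(0;0,1)` ones over all limit states.**  If
`∫ exp((β/2)(N − P_{(x;0,1)})) dν ≤ C` for every `ν ∈ infiniteVolumeLimitPoints ρ β` and every site `x`, then for every limit state `μ`, site `y`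
and plane `k < l`: `∫ exp((β/2)(N − P_{(y;k,l)})) dμ ≤ C` — the translate `(θ_{−y})_* μ` and its axis permutation are again limit states.
[folklore] -/
theorem expMoment_allPlanes (ρ : G →* Matrix (Fin N) (Fin N) ℂ) (hρ : Continuous ρ) {β C : ℝ}
    (hb : ∀ ν ∈ infiniteVolumeLimitPoints (d := 4) ρ β, ∀ x : Literature.Probability.LatticeModels.Site 4,
      ∫ U, Real.exp (β / 2 * ((N : ℝ) - plaquetteObs ρ x 0 1 U)) ∂ν ≤ C)
    {μ : Measure (LGConfig 4 G)} (hμ : μ ∈ infiniteVolumeLimitPoints (d := 4) ρ β)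
    (y : Literature.Probability.LatticeModels.Site 4) {k l : Fin 4} (hkl : k < l) :
    ∫ U, Real.exp (β / 2 * ((N : ℝ) - plaquetteObs ρ y k l U)) ∂μ ≤ C := by
  obtain ⟨π, hπ0, hπ1⟩ := exists_perm_symm_eq k l hkl
  have h1 := map_configShift_mem_infiniteVolumeLimitPoints ρ hμ (-y)
  have h2 := map_configPermZd_mem_infiniteVolumeLimitPoints ρ hρ h1 π
  have key := hb _ h2 0
  simp only [integral_map_equiv, plaquetteObs_configPermZd, sitePermZd_zero, hπ0, hπ1,
    Literature.Barriers.QuantumFields.plaquetteObs_configShift, sub_neg_eq_add, zero_add] at key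
  exact key

end Symmetry

/-! ### The second-order local law for a pair of plaquettes (contradiction wrapper) -/

open Summit.QuantumFields.YangMills.Theorems.EquipartitionPinsProbe in
open Summit.QuantumFields.YangMills.Theorems.LocalGaussianityExpMomentTangentLaw in
open Summit.QuantumFields.YangMills.Theorems.LocalGaussianityExpMomentTangentLaw.SecondOrder in
/-- **The second-order local free-gluon law for every pair of plaquettes, from the tangent law and chessboard exponential moments.**
For a compact simple `G` (with its Borel σ-algebra) and a faithful unitary lattice representation `r`, GIVEN the free-energy asymptotics
`f_r(β) + (3D_r/2) log β → K` and uniform exponential moments of the scaled plaquette costs in EVERY plane over torus-limit states at large `β`: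
there is `D ≥ 1` such that for every two plaquettes `p, q` and `ε > 0` there is `β₁` with
`|β² · plaquetteCorr r.ρ μ p q − (D/2) · (curvatureTwoPoint p q)²| < ε` for all `β ≥ β₁` and all `μ ∈ infiniteVolumeLimitPoints r.ρ β`. -/
theorem secondOrder_pair_of_expMoment :
    ∀ (G : Type) [Group G] [TopologicalSpace G] [IsTopologicalGroup G] [CompactSpace G],
      IsCompactSimpleLieGroup G →
      letI : MeasurableSpace G := borel G
      haveI : BorelSpace G := ⟨rfl⟩
      ∀ r : LatticeRep G,
        (∃ K : ℝ, Tendsto (fun β : ℝ => freeEnergyDensity 4 r.ρ β +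
          (3 * (Module.finrank ℝ ↥(Submodule.span ℝ {X : Matrix (Fin r.N) (Fin r.N) ℂ |
            ∀ t : ℝ, NormedSpace.exp ((t : ℂ) • X) ∈ Set.range r.ρ}) : ℝ) / 2) * Real.log β) atTop (nhds K)) →
        (∃ C β₁ : ℝ, ∀ β : ℝ, β₁ ≤ β → ∀ μ ∈ infiniteVolumeLimitPoints (d := 4) r.ρ β,
          ∀ (x : Literature.Probability.LatticeModels.Site 4) (i j : Fin 4), i < j →
            ∫ U, Real.exp (β / 2 * ((r.N : ℝ) - plaquetteObs r.ρ x i j U)) ∂μ ≤ C) →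
        ∃ D : ℕ, 0 < D ∧ ∀ (p q : ZdPlaquette 4) (ε : ℝ), 0 < ε → ∃ β₁ : ℝ, ∀ β : ℝ, β₁ ≤ β →
          ∀ μ ∈ infiniteVolumeLimitPoints (d := 4) r.ρ β,
            |β ^ 2 * plaquetteCorr r.ρ μ p.1 p.2.1.1 p.2.1.2 q.1 q.2.1.1 q.2.1.2 -
              (D : ℝ) / 2 * curvatureTwoPoint p q ^ 2| < ε := by
  intro G _ _ _ _ hG
  letI : MeasurableSpace G := borel G
  haveI : BorelSpace G := ⟨rfl⟩
  intro r hK hexp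
  haveI : SecondCountableTopology G :=
    (r.continuous.isClosedEmbedding r.injective).isEmbedding.secondCountableTopology
  obtain ⟨D, hD, hTan⟩ := stub_tangent G hG r (stub_equipartition G hG r hK)
  have hR := stub_rigidity
    (stub_factorization (stub_exactShiftInvariance stub_steinFlow stub_kernelFixesExact)
      (stub_cubeShiftInvariance stub_kernelClosed) stub_density)
    stub_cosMoment stub_lineVariance stub_gaussFromCharFun
  obtain ⟨C, β₁, hC⟩ := hexp
  refine ⟨D, hD, fun p0 pn ε hε => ?_⟩
  set L : ℝ := (D : ℝ) / 2 * curvatureTwoPoint p0 pn ^ 2 with hL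
  by_contra hcon
  push Not at hcon
  choose βs hβs μs hμs hbad using fun k : ℕ => hcon (max (k : ℝ) β₁)
  have hβk : ∀ k : ℕ, (k : ℝ) ≤ βs k := fun k => (le_max_left _ _).trans (hβs k)
  have hβ1 : ∀ k, β₁ ≤ βs k := fun k => (le_max_right _ _).trans (hβs k)
  have hβ0 : ∀ k, 0 ≤ βs k := fun k => (Nat.cast_nonneg k).trans (hβk k)
  have hβtend : Tendsto βs atTop atTop := tendsto_atTop_mono hβk tendsto_natCast_atTop_atTop
  obtain ⟨φ, τ, hφ, hτ, hT0, hT1, hT2, hT3⟩ := hTan βs μs hβtend hμs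
  have hτeq : τ = curvatureGaussianField 4 D := hR D τ hτ hT1 hT2 hT3
  subst hτeq
  have hprob : ∀ k, IsProbabilityMeasure (μs k) := fun k => by
    obtain ⟨Lk, -, hP, -⟩ := hμs k
    exact hP
  -- the plaquette observables and the scaled costs, indexed by plaquettes
  have hPc : ∀ p : ZdPlaquette 4, Continuous (plaquetteObs r.ρ p.1 p.2.1.1 p.2.1.2) :=
    fun p => continuous_plaquetteObs r.ρ r.continuous p.1 p.2.1.1 p.2.1.2
  have hPabs : ∀ (p : ZdPlaquette 4) (U : LGConfig 4 G), |plaquetteObs r.ρ p.1 p.2.1.1 p.2.1.2 U| ≤ r.N := fun p U => by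
    have h := Literature.RepresentationTheory.CompactGroups.CompactGroup.abs_re_trace_le_card r.ρ r.continuous
      (plaquetteHolonomyZd U p.1 p.2.1.1 p.2.1.2)
    simpa only [Fintype.card_fin, plaquetteObs] using h
  have hPi : ∀ (k : ℕ) (p : ZdPlaquette 4), Integrable (plaquetteObs r.ρ p.1 p.2.1.1 p.2.1.2) (μs k) :=
    fun k p => by
      haveI := hprob k
      exact integrable_of_abs_le (hPc p).aestronglyMeasurable (hPabs p)
  have hPPi : ∀ (k : ℕ) (p q : ZdPlaquette 4),
      Integrable (fun U => plaquetteObs r.ρ p.1 p.2.1.1 p.2.1.2 U * plaquetteObs r.ρ q.1 q.2.1.1 q.2.1.2 U) (μs k) := fun k p q => by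
    haveI := hprob k
    exact integrable_of_abs_le ((hPc p).mul (hPc q)).aestronglyMeasurable (K := (r.N : ℝ) * r.N) fun U => by
      rw [abs_mul]
      exact mul_le_mul (hPabs p U) (hPabs q U) (abs_nonneg _) (Nat.cast_nonneg _)
  set X : ℕ → ZdPlaquette 4 → LGConfig 4 G → ℝ :=
    fun k p U => βs k * ((r.N : ℝ) - plaquetteObs r.ρ p.1 p.2.1.1 p.2.1.2 U) with hX
  have hX0 : ∀ k p U, 0 ≤ X k p U := fun k p U =>
    mul_nonneg (hβ0 k) (sub_nonneg.2 (abs_le.1 (hPabs p U)).2)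
  have hXB : ∀ k p U, X k p U ≤ βs k * (2 * r.N) := fun k p U =>
    mul_le_mul_of_nonneg_left (by linarith [(abs_le.1 (hPabs p U)).1]) (hβ0 k)
  have hXm : ∀ k p, AEStronglyMeasurable (X k p) (μs k) := fun k p =>
    (continuous_const.mul (continuous_const.sub (hPc p))).aestronglyMeasurable
  have hXe : ∀ (k : ℕ) (p : ZdPlaquette 4), ∫ U, Real.exp (X k p U / 2) ∂(μs k) ≤ C := fun k p => by
    have h := hC (βs k) (hβ1 k) (μs k) (hμs k) p.1 p.2.1.1 p.2.1.2 p.2.2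
    have heq : (fun U => Real.exp (X k p U / 2)) =
        fun U => Real.exp (βs k / 2 * ((r.N : ℝ) - plaquetteObs r.ρ p.1 p.2.1.1 p.2.1.2 U)) := by
      funext U
      congr 1
      simp only [hX]
      ring
    rw [heq]
    exact h
  -- uniform truncation error (the exponential moments give uniform integrability)
  have htrunc : ∀ (k : ℕ) {M : ℝ}, 0 < M →
      |((∫ U, X k p0 U * X k pn U ∂(μs k)) - (∫ U, X k p0 U ∂(μs k)) * (∫ U, X k pn U ∂(μs k))) -
        ((∫ U, min (max (X k p0 U) 0) M * min (max (X k pn U) 0) M ∂(μs k)) -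
          (∫ U, min (max (X k p0 U) 0) M ∂(μs k)) * (∫ U, min (max (X k pn U) 0) M ∂(μs k)))| ≤
        (96 * C + 32 * C ^ 2) / M := fun k M hM => by
    haveI := hprob k
    exact abs_cov_sub_truncated_le (hXm k p0) (hXm k pn) (hX0 k p0) (hX0 k pn) (hXB k p0) (hXB k pn)
      (hXe k p0) (hXe k pn) hM
  -- the covariance of the scaled costs is `β² · plaquetteCorr`
  have hcov : ∀ k, (∫ U, X k p0 U * X k pn U ∂(μs k)) - (∫ U, X k p0 U ∂(μs k)) * (∫ U, X k pn U ∂(μs k)) =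
      βs k ^ 2 * plaquetteCorr r.ρ (μs k) p0.1 p0.2.1.1 p0.2.1.2 pn.1 pn.2.1.1 pn.2.1.2 := fun k => by
    haveI := hprob k
    exact cov_scaled_eq r.ρ (μs k) (βs k) p0.1 p0.2.1.1 p0.2.1.2 pn.1 pn.2.1.1 pn.2.1.2 (hPi k p0) (hPi k pn) (hPPi k p0 pn)
  -- the Gaussian side: truncated covariances → `L`
  have hGauss := GaussMoments.tendsto_truncated_cov D p0 pn
  have hKM : Tendsto (fun M : ℕ => (96 * C + 32 * C ^ 2) / (M : ℝ)) atTop (𝓝 0) :=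
    tendsto_const_div_atTop_nhds_zero_nat _
  have hε3 : 0 < ε / 3 := by positivity
  obtain ⟨M, hM1, hMG, hMK⟩ : ∃ M : ℕ, 1 ≤ M ∧
      dist ((∫ Y, min (max ((1 / 2 : ℝ) * ∑ a : Fin D, (Y p0 a) ^ 2) 0) (M : ℝ) *
          min (max ((1 / 2 : ℝ) * ∑ b : Fin D, (Y pn b) ^ 2) 0) (M : ℝ) ∂(curvatureGaussianField 4 D)) -
        (∫ Y, min (max ((1 / 2 : ℝ) * ∑ a : Fin D, (Y p0 a) ^ 2) 0) (M : ℝ) ∂(curvatureGaussianField 4 D)) *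
          (∫ Y, min (max ((1 / 2 : ℝ) * ∑ b : Fin D, (Y pn b) ^ 2) 0) (M : ℝ) ∂(curvatureGaussianField 4 D)))
        L < ε / 3 ∧
      (96 * C + 32 * C ^ 2) / (M : ℝ) < ε / 3 :=
    ((eventually_ge_atTop 1).and (((Metric.tendsto_nhds.1 hGauss) (ε / 3) hε3).and
      (hKM.eventually (gt_mem_nhds hε3)))).exists
  have hM0 : (0 : ℝ) < M := by exact_mod_cast hM1
  rw [Real.dist_eq] at hMG
  -- (T0) at the two plaquettes with the truncated test functions
  set cM : ℝ → ℝ := fun t => min (max t 0) (M : ℝ) with hcM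
  have hcMc : Continuous cM := GaussMoments.continuous_clamp (M : ℝ)
  have hcMb : ∀ t, |cM t| ≤ M := fun t => GaussMoments.abs_clamp_le t (Nat.cast_nonneg M)
  set f2 : (Fin 2 → ℝ) → ℝ := fun v => cM (v 0) * cM (v 1) with hf2
  set fa : (Fin 2 → ℝ) → ℝ := fun v => cM (v 0) with hfa
  set fb : (Fin 2 → ℝ) → ℝ := fun v => cM (v 1) with hfb
  have hf2c : Continuous f2 := (hcMc.comp (continuous_apply 0)).mul (hcMc.comp (continuous_apply 1))
  have hfac : Continuous fa := hcMc.comp (continuous_apply 0)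
  have hfbc : Continuous fb := hcMc.comp (continuous_apply 1)
  have hf2b : ∃ C' : ℝ, ∀ v, |f2 v| ≤ C' := ⟨(M : ℝ) * M, fun v => by
    simp only [hf2, abs_mul]
    exact mul_le_mul (hcMb _) (hcMb _) (abs_nonneg _) (Nat.cast_nonneg M)⟩
  have hfab : ∃ C' : ℝ, ∀ v, |fa v| ≤ C' := ⟨M, fun v => hcMb _⟩
  have hfbb : ∃ C' : ℝ, ∀ v, |fb v| ≤ C' := ⟨M, fun v => hcMb _⟩
  have l2 := hT0 2 ![p0, pn] f2 hf2c hf2b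
  have la := hT0 2 ![p0, pn] fa hfac hfab
  have lb := hT0 2 ![p0, pn] fb hfbc hfbb
  -- identify the lattice integrands
  have hL2 : ∀ (j : ℕ) (U : LGConfig 4 G),
      f2 (fun i => βs (φ j) * ((r.N : ℝ) - plaquetteObs r.ρ
          ((![p0, pn] : Fin 2 → ZdPlaquette 4) i).1 ((![p0, pn] : Fin 2 → ZdPlaquette 4) i).2.1.1
          ((![p0, pn] : Fin 2 → ZdPlaquette 4) i).2.1.2 U)) =
        cM (X (φ j) p0 U) * cM (X (φ j) pn U) := by
    intro j U
    simp only [hf2, hX, Matrix.cons_val_zero, Matrix.cons_val_one, Matrix.cons_val_fin_one]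
  have hLa : ∀ (j : ℕ) (U : LGConfig 4 G),
      fa (fun i => βs (φ j) * ((r.N : ℝ) - plaquetteObs r.ρ
          ((![p0, pn] : Fin 2 → ZdPlaquette 4) i).1 ((![p0, pn] : Fin 2 → ZdPlaquette 4) i).2.1.1
          ((![p0, pn] : Fin 2 → ZdPlaquette 4) i).2.1.2 U)) = cM (X (φ j) p0 U) := by
    intro j U
    simp only [hfa, hX, Matrix.cons_val_zero]
  have hLb : ∀ (j : ℕ) (U : LGConfig 4 G),
      fb (fun i => βs (φ j) * ((r.N : ℝ) - plaquetteObs r.ρ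
          ((![p0, pn] : Fin 2 → ZdPlaquette 4) i).1 ((![p0, pn] : Fin 2 → ZdPlaquette 4) i).2.1.1
          ((![p0, pn] : Fin 2 → ZdPlaquette 4) i).2.1.2 U)) = cM (X (φ j) pn U) := by
    intro j U
    simp only [hfb, hX, Matrix.cons_val_one, Matrix.cons_val_fin_one]
  -- identify the Gaussian integrands
  have hG2 : ∀ Y : ZdPlaquette 4 → Fin D → ℝ,
      f2 (fun i => (1 / 2 : ℝ) * ∑ a : Fin D, (Y ((![p0, pn] : Fin 2 → ZdPlaquette 4) i) a) ^ 2) =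
        cM ((1 / 2 : ℝ) * ∑ a : Fin D, (Y p0 a) ^ 2) * cM ((1 / 2 : ℝ) * ∑ b : Fin D, (Y pn b) ^ 2) := by
    intro Y
    simp only [hf2, Matrix.cons_val_zero, Matrix.cons_val_one, Matrix.cons_val_fin_one]
  have hGa : ∀ Y : ZdPlaquette 4 → Fin D → ℝ,
      fa (fun i => (1 / 2 : ℝ) * ∑ a : Fin D, (Y ((![p0, pn] : Fin 2 → ZdPlaquette 4) i) a) ^ 2) =
        cM ((1 / 2 : ℝ) * ∑ a : Fin D, (Y p0 a) ^ 2) := by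
    intro Y
    simp only [hfa, Matrix.cons_val_zero]
  have hGb : ∀ Y : ZdPlaquette 4 → Fin D → ℝ,
      fb (fun i => (1 / 2 : ℝ) * ∑ a : Fin D, (Y ((![p0, pn] : Fin 2 → ZdPlaquette 4) i) a) ^ 2) =
        cM ((1 / 2 : ℝ) * ∑ b : Fin D, (Y pn b) ^ 2) := by
    intro Y
    simp only [hfb, Matrix.cons_val_one, Matrix.cons_val_fin_one]
  simp only [hL2, hG2] at l2
  simp only [hLa, hGa] at la
  simp only [hLb, hGb] at lb
  have lcov := l2.sub (la.mul lb)
  have hev := (Metric.tendsto_nhds.1 lcov) (ε / 3) hε3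
  obtain ⟨j, hj⟩ := hev.exists
  rw [Real.dist_eq] at hj
  -- combine at `k = φ j`
  have hk := hbad (φ j)
  have h1 := htrunc (φ j) hM0
  rw [hcov (φ j)] at h1
  simp only [hcM] at hj
  have htri := abs_sub_le (βs (φ j) ^ 2 * plaquetteCorr r.ρ (μs (φ j)) p0.1 p0.2.1.1 p0.2.1.2 pn.1 pn.2.1.1 pn.2.1.2)
    ((∫ U, min (max (X (φ j) p0 U) 0) M * min (max (X (φ j) pn U) 0) M ∂(μs (φ j))) -
      (∫ U, min (max (X (φ j) p0 U) 0) M ∂(μs (φ j))) * (∫ U, min (max (X (φ j) pn U) 0) M ∂(μs (φ j)))) L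
  have htri2 := abs_sub_le
    ((∫ U, min (max (X (φ j) p0 U) 0) M * min (max (X (φ j) pn U) 0) M ∂(μs (φ j))) -
      (∫ U, min (max (X (φ j) p0 U) 0) M ∂(μs (φ j))) * (∫ U, min (max (X (φ j) pn U) 0) M ∂(μs (φ j))))
    ((∫ Y, min (max ((1 / 2 : ℝ) * ∑ a : Fin D, (Y p0 a) ^ 2) 0) (M : ℝ) *
          min (max ((1 / 2 : ℝ) * ∑ b : Fin D, (Y pn b) ^ 2) 0) (M : ℝ) ∂(curvatureGaussianField 4 D)) -
        (∫ Y, min (max ((1 / 2 : ℝ) * ∑ a : Fin D, (Y p0 a) ^ 2) 0) (M : ℝ) ∂(curvatureGaussianField 4 D)) *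
          (∫ Y, min (max ((1 / 2 : ℝ) * ∑ b : Fin D, (Y pn b) ^ 2) 0) (M : ℝ) ∂(curvatureGaussianField 4 D))) L
  linarith

end CrossPlane

end Summit.QuantumFields.YangMills.Theorems.HankelDensitySplitting

end
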